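import Literature.MathematicalPhysics.QuantumLattice.GrassmannWeightedGaussConvBinomialGramPrescribed
import Literature.MathematicalPhysics.QuantumLattice.GrassmannKernelMeanValue
import Literature.MathematicalPhysics.QuantumLattice.GrassmannGaussConvKernelBound
import Literature.MathematicalPhysics.QuantumLattice.GrassmannGramBoundedWeights
import HarnessLib

/-!
# The linear part `e^{Δ_C} H − H` with ONE contraction at ENTRY cost and the others in Gram form, decay-weighted

Topic `MathematicalPhysics/QuantumLattice`; companion of `GrassmannGaussConvKernelBound` (`e^{Δ_C} W − W` kernel by kernel, every
self-contraction at the SUP ENTRY `s` of the covariance — the pattern count `(m+2j)!/(m! j! 2^j)` is factorial in the number `j` of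
contracted pairs) and of `GrassmannWeightedGaussConvBinomialGramPrescribed` (`e^{Δ_C} H − H` in binomial–GRAM form,
`Σ_{m' > p} C(2m',2p) κ^{2m'−2p} N(m')` — uniform in the label set, but every contraction costs the Gram constant `κ²`, which for a DEFECT
covariance (small entries and row sums, Gram constant of order one: masks and sums of Gram-bounded covariances keep the constant, not the
smallness) is not small).  The two are combined along the Duhamel path `t ↦ e^{Δ_{tC}} H` (Salmhofer 1998, §3.1 Prop. 1:
`∂_t e^{Δ_{tC}} H = Δ_C e^{Δ_{tC}} H`, the tree's `hasCoeffDerivAt_gaussConv_apply`; §4.1: integrate and bound the kernels of the right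
side, the tree's `GrassmannKernelMeanValue`): the ONE explicit Laplacian costs the sup entry `s` (`kernel_grassmannLaplacian`: the
degree-`m+2` kernel contracted on its last two legs, `(m+1)(m+2)/2` positions), and the kernels of `e^{Δ_{tC}} H` are bounded in
binomial–Gram form UNIFORMLY in `t ∈ [0,1]` (`t • C` has the Gram constant of `C`, `isGramBoundedR_real_smul`).  In the `IsTreeWeight wt`
weighted pinned `L¹–L^∞` norms (Benfatto–Giuliani–Mastropietro 2006, §3 (3.2)–(3.8); the weight of the output label set is at most the
weight of the input label set, which contains it):

* `re_sum_conj_mul_le_sum_mul_norm`, `sum_mul_norm_eq_re_sum_conj_mul`, `norm_ofReal_mul_phase_le` — weighted `ℓ¹` duality;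
* `sum_mul_norm_kernel_sub_le_of_hasCoeffDerivAt` — the weighted twin of `sum_norm_kernel_sub_le_of_hasCoeffDerivAt` (nonnegative weights
  `c Y` on the label strings);
* (private copy of the `wt`-weighted Wick bound for one Laplacian, `GrassmannWeightedFlowStep.sum_wt_norm_kernel_grassmannLaplacian_le`:
  `Σ_{X : X_i = w} wt(X) ‖kernel (Δ_C W) m X‖ ≤ ((m+1)(m+2)/2)·s·Σ_{Z : Z_i = w} wt(Z) ‖kernel W (m+2) Z‖` — the output label set is contained
  in the input label set);
* **`sum_wt_norm_kernel_gaussConv_sub_le_entry_of_gramBounded`** — for `C` replica-Gram-bounded (constant `κ ≥ 0`) with entries `≤ s`,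
  `H` even with `wt`-weighted pinned profile `N(m')` in degree `2m'`, in every degree `m`, one output leg pinned:
  `Σ_{X : X_i = w} wt(X) ‖kernel (e^{Δ_C} H) m X − kernel H m X‖ ≤ ((m+1)(m+2)/2) · s · Σ_{m' : m+2 ≤ 2m'} C(2m', m+2) κ^{2m'−m−2} N(m')`
  — ONE power of the (small) entry bound, no factorial, the remaining contractions in Gram form (the `m' = (m+2)/2` term is the single
  contraction itself);
* `sum_wt_norm_kernel_gaussConv_sub_le_entry_of_gramBounded_even` — the same in an even degree `2p`, prefactor `(p+1)(2p+1)·s`, sum over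
  `m' ≥ p+1` of `C(2m', 2p+2) κ^{2(m'−p−1)} N(m')` (the currency of a graded tower: first order of a NEAR-IDENTITY step, e.g. the near
  half of the defect-covariance source of a nested two-volume comparison, BGM 2006 (2.86)–(2.90)).

Everything is proved; no definition, no named fact.

## Sources

M. Salmhofer, Commun. Math. Phys. 194 (1998) 249–295, §3.1 Prop. 1, §4.1 [`Salmhofer1998`]; G. Benfatto, A. Giuliani, V. Mastropietro,
Ann. Henri Poincaré 7 (2006) 809–898, (2.61)–(2.63), (2.77)–(2.80), (2.86)–(2.90), §3 (3.2)–(3.8) [`BenfattoGiulianiMastropietro2006`];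
M. Salmhofer, *Renormalization: An Introduction* (Springer 1999), §4.3 (4.86)–(4.95) [`Salmhofer1999`].
-/

noncomputable section

namespace Literature.MathematicalPhysics.QuantumLattice

open GrassmannAlgebra Finset Literature.Probability.LatticeModels Literature.Probability.LatticeModels.BattleFederbush
open scoped Nat ComplexConjugate

universe u

/-! ### §0 Weighted `ℓ¹` duality and the weighted mean-value bound -/

section Duality

variable {𝕜 : Type*} [RCLike 𝕜] {ι : Type*}

/-- `Re Σ_Y conj(u Y)·a Y ≤ Σ_Y c Y ‖a Y‖` whenever `‖u Y‖ ≤ c Y`. [cite: Salmhofer1998, §4.1] -/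
theorem re_sum_conj_mul_le_sum_mul_norm (s : Finset ι) (u a : ι → 𝕜) (c : ι → ℝ) (hu : ∀ Y, ‖u Y‖ ≤ c Y) :
    RCLike.re (∑ Y ∈ s, conj (u Y) * a Y) ≤ ∑ Y ∈ s, c Y * ‖a Y‖ := by
  rw [map_sum]
  refine sum_le_sum fun Y _ => ?_
  calc RCLike.re (conj (u Y) * a Y) ≤ ‖conj (u Y) * a Y‖ := RCLike.re_le_norm _
    _ = ‖u Y‖ * ‖a Y‖ := by rw [norm_mul, RCLike.norm_conj]
    _ ≤ c Y * ‖a Y‖ := mul_le_mul_of_nonneg_right (hu Y) (norm_nonneg _)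

/-- With the weighted phases `u Y = c Y · a Y/‖a Y‖`: `Σ_Y c Y ‖a Y‖ = Re Σ_Y conj(u Y)·a Y`. [cite: Salmhofer1998, §4.1] -/
theorem sum_mul_norm_eq_re_sum_conj_mul (s : Finset ι) (a : ι → 𝕜) (c : ι → ℝ) :
    (∑ Y ∈ s, c Y * ‖a Y‖ : ℝ) = RCLike.re (∑ Y ∈ s, conj (((c Y : ℝ) : 𝕜) * (a Y / (‖a Y‖ : 𝕜))) * a Y) := by
  rw [map_sum]
  refine sum_congr rfl fun Y _ => ?_
  rw [map_mul (starRingEnd 𝕜), RCLike.conj_ofReal, mul_assoc, RCLike.re_ofReal_mul]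
  congr 1
  have h := sum_norm_eq_re_sum_conj_phase_mul ({Y} : Finset ι) a
  simpa using h

/-- The weighted phases have norm `≤ c` (`0 ≤ c`). [cite: Salmhofer1998, §4.1] -/
theorem norm_ofReal_mul_phase_le (a : 𝕜) {c : ℝ} (hc : 0 ≤ c) : ‖((c : ℝ) : 𝕜) * (a / (‖a‖ : 𝕜))‖ ≤ c := by
  rw [norm_mul, RCLike.norm_ofReal, abs_of_nonneg hc]
  exact (mul_le_mul_of_nonneg_left (norm_phase_le_one a) hc).trans_eq (mul_one c)

end Duality

section MVT

variable {𝕜 : Type*} [RCLike 𝕜] {Γ : Type*} [LinearOrder Γ] [Fintype Γ]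

/-- **WEIGHTED MEAN-VALUE BOUND FOR THE PINNED KERNEL SUMS ALONG A CURVE.**  If `s ↦ X s` has coefficientwise derivative `X′ s` at every
`s ∈ [0,1]`, `0 ≤ c`, and `Σ_{Y ∈ P} c Y ‖kernel (X′ s) m Y‖ ≤ B` for all `s ∈ [0,1]`, then
`Σ_{Y ∈ P} c Y ‖kernel (X 1) m Y − kernel (X 0) m Y‖ ≤ B`. [cite: Salmhofer1998, §4.1 (integration of the RGE)] -/
theorem sum_mul_norm_kernel_sub_le_of_hasCoeffDerivAt {X : ℝ → GrassmannAlgebra 𝕜 Γ} {X' : ℝ → GrassmannAlgebra 𝕜 Γ}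
    (hX : ∀ s ∈ Set.Icc (0 : ℝ) 1, HasCoeffDerivAt X (X' s) s) (m : ℕ) (P : Finset (Fin m → Γ)) (c : (Fin m → Γ) → ℝ)
    (hc : ∀ Y, 0 ≤ c Y) {B : ℝ}
    (hB : ∀ s ∈ Set.Icc (0 : ℝ) 1, ∑ Y ∈ P, c Y * ‖kernel 𝕜 (X' s) m Y‖ ≤ B) :
    ∑ Y ∈ P, c Y * ‖kernel 𝕜 (X 1) m Y - kernel 𝕜 (X 0) m Y‖ ≤ B := by
  -- the weighted phases of the difference and the scalar test function
  set a : (Fin m → Γ) → 𝕜 := fun Y => kernel 𝕜 (X 1) m Y - kernel 𝕜 (X 0) m Y with ha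
  set u : (Fin m → Γ) → 𝕜 := fun Y => ((c Y : ℝ) : 𝕜) * (a Y / (‖a Y‖ : 𝕜)) with hu
  set g : ℝ → ℝ := fun s => RCLike.re (∑ Y ∈ P, conj (u Y) * kernel 𝕜 (X s) m Y) with hg
  set g' : ℝ → ℝ := fun s => RCLike.re (∑ Y ∈ P, conj (u Y) * kernel 𝕜 (X' s) m Y) with hg'
  -- `g` is differentiable with derivative `g'`
  have hderiv : ∀ s ∈ Set.Icc (0 : ℝ) 1, HasDerivWithinAt g (g' s) (Set.Icc (0 : ℝ) 1) s := by
    intro s hs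
    have hsum : HasDerivAt (fun r => ∑ Y ∈ P, conj (u Y) * kernel 𝕜 (X r) m Y) (∑ Y ∈ P, conj (u Y) * kernel 𝕜 (X' s) m Y) s :=
      HasDerivAt.fun_sum fun Y _ => (hasDerivAt_kernel_of_hasCoeffDerivAt (hX s hs) m Y).const_mul _
    have hre := (RCLike.reCLM : 𝕜 →L[ℝ] ℝ).hasFDerivAt.comp_hasDerivAt s hsum
    exact hre.hasDerivWithinAt
  have hbound : ∀ s ∈ Set.Ico (0 : ℝ) 1, ‖g' s‖ ≤ B := by
    intro s hs
    have hs' : s ∈ Set.Icc (0 : ℝ) 1 := Set.Ico_subset_Icc_self hs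
    rw [hg', Real.norm_eq_abs, abs_le]
    constructor
    · -- `-B ≤ g' s` from the bound applied to `-u`
      have h := re_sum_conj_mul_le_sum_mul_norm P (fun Y => -u Y) (fun Y => kernel 𝕜 (X' s) m Y) c
        (fun Y => by rw [norm_neg]; exact norm_ofReal_mul_phase_le _ (hc Y))
      simp only [map_neg, neg_mul, sum_neg_distrib] at h
      linarith [hB s hs']
    · exact (re_sum_conj_mul_le_sum_mul_norm P u (fun Y => kernel 𝕜 (X' s) m Y) c
        fun Y => norm_ofReal_mul_phase_le _ (hc Y)).trans (hB s hs')
  have hmvt := norm_image_sub_le_of_norm_deriv_le_segment_01' hderiv hbound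
  -- duality: `g 1 - g 0 = Σ c Y ‖a Y‖`
  have hdiff : g 1 - g 0 = ∑ Y ∈ P, c Y * ‖a Y‖ := by
    rw [hg]
    simp only
    rw [← map_sub, ← sum_sub_distrib, sum_mul_norm_eq_re_sum_conj_mul P a c]
    congr 1
    refine sum_congr rfl fun Y _ => ?_
    rw [← mul_sub]
  calc ∑ Y ∈ P, c Y * ‖kernel 𝕜 (X 1) m Y - kernel 𝕜 (X 0) m Y‖ = g 1 - g 0 := hdiff.symm
    _ ≤ ‖g 1 - g 0‖ := Real.le_norm_self _
    _ ≤ B := hmvt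

end MVT

/-! ### §1 The weighted Wick bound for one Laplacian (private copy of `GrassmannWeightedFlowStep`'s lemma, to keep the import closure small) -/

section Laplacian

variable {𝕜 : Type*} [RCLike 𝕜] {Γ : Type*} [Fintype Γ] [DecidableEq Γ] {wt : Finset Γ → ℝ}

/-- The weighted Wick bound for one Laplacian, one output leg pinned (copy of
`GrassmannWeightedFlowStep.sum_wt_norm_kernel_grassmannLaplacian_le`). [cite: BenfattoGiulianiMastropietro2006, (2.86)-(2.90)] -/
private theorem sum_wt_norm_kernel_grassmannLaplacian_le' (hwt : IsTreeWeight wt) (C : Matrix Γ Γ 𝕜) {s : ℝ}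
    (hs : ∀ A B, ‖C A B‖ ≤ s) (W : GrassmannAlgebra 𝕜 Γ) (m : ℕ) (i : Fin m) (w : Γ) :
    ∑ X ∈ univ.filter (fun X : Fin m → Γ => X i = w), wt (univ.image X) * ‖kernel 𝕜 (grassmannLaplacian 𝕜 C W) m X‖ ≤
      (((m + 1) * (m + 2) : ℕ) : ℝ) / 2 * s *
        ∑ Z ∈ univ.filter (fun Z : Fin (m + 1 + 1) → Γ => Z (Fin.castSucc (Fin.castSucc i)) = w),
          wt (univ.image Z) * ‖kernel 𝕜 W (m + 2) Z‖ := by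
  have hs0 : 0 ≤ s := le_trans (norm_nonneg _) (hs w w)
  have hcoef : ‖(((((m + 1) * (m + 2) : ℕ) : ℚ) / 2) • (1 : 𝕜))‖ = (((m + 1) * (m + 2) : ℕ) : ℝ) / 2 := by
    rw [Rat.smul_one_eq_cast, ← RCLike.ofReal_ratCast, RCLike.norm_ofReal]
    push_cast
    exact abs_of_nonneg (by positivity)
  -- the weight of `X` is at most the weight of `(X, B, A)`
  have hmono : ∀ (X : Fin m → Γ) (A B : Γ),
      wt (univ.image X) ≤ wt (univ.image (Fin.snoc (Fin.snoc X B : Fin (m + 1) → Γ) A)) := by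
    intro X A B
    refine hwt.mono fun x hx => ?_
    obtain ⟨j, -, rfl⟩ := mem_image.1 hx
    refine mem_image.2 ⟨Fin.castSucc (Fin.castSucc j), mem_univ _, ?_⟩
    simp only [Fin.snoc_castSucc]
  -- pointwise
  have hpt : ∀ X : Fin m → Γ, wt (univ.image X) * ‖kernel 𝕜 (grassmannLaplacian 𝕜 C W) m X‖ ≤
      (((m + 1) * (m + 2) : ℕ) : ℝ) / 2 * s *
        ∑ A, ∑ B, wt (univ.image (Fin.snoc (Fin.snoc X B : Fin (m + 1) → Γ) A)) *
          ‖kernel 𝕜 W (m + 2) (Fin.snoc (Fin.snoc X B : Fin (m + 1) → Γ) A)‖ := by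
    intro X
    rw [kernel_grassmannLaplacian, norm_mul, hcoef, mul_left_comm, mul_assoc]
    refine mul_le_mul_of_nonneg_left ?_ (by positivity)
    calc wt (univ.image X) * ‖∑ A, ∑ B, C A B * kernel 𝕜 W (m + 2) (Fin.snoc (Fin.snoc X B : Fin (m + 1) → Γ) A)‖
        ≤ wt (univ.image X) * ∑ A, ∑ B, ‖C A B‖ * ‖kernel 𝕜 W (m + 2) (Fin.snoc (Fin.snoc X B : Fin (m + 1) → Γ) A)‖ := by
          refine mul_le_mul_of_nonneg_left ?_ (hwt.nonneg _)
          refine (norm_sum_le _ _).trans (sum_le_sum fun A _ => (norm_sum_le _ _).trans (sum_le_sum fun B _ => ?_))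
          rw [norm_mul]
      _ = ∑ A, ∑ B, ‖C A B‖ * (wt (univ.image X) * ‖kernel 𝕜 W (m + 2) (Fin.snoc (Fin.snoc X B : Fin (m + 1) → Γ) A)‖) := by
          rw [mul_sum]
          refine sum_congr rfl fun A _ => ?_
          rw [mul_sum]
          refine sum_congr rfl fun B _ => ?_
          ring
      _ ≤ ∑ A, ∑ B, s * (wt (univ.image (Fin.snoc (Fin.snoc X B : Fin (m + 1) → Γ) A)) *
            ‖kernel 𝕜 W (m + 2) (Fin.snoc (Fin.snoc X B : Fin (m + 1) → Γ) A)‖) :=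
          sum_le_sum fun A _ => sum_le_sum fun B _ =>
            mul_le_mul (hs A B) (mul_le_mul_of_nonneg_right (hmono X A B) (norm_nonneg _))
              (mul_nonneg (hwt.nonneg _) (norm_nonneg _)) hs0
      _ = s * ∑ A, ∑ B, wt (univ.image (Fin.snoc (Fin.snoc X B : Fin (m + 1) → Γ) A)) *
            ‖kernel 𝕜 W (m + 2) (Fin.snoc (Fin.snoc X B : Fin (m + 1) → Γ) A)‖ := by
          rw [mul_sum]
          refine sum_congr rfl fun A _ => ?_
          rw [mul_sum]
  refine (sum_le_sum fun X _ => hpt X).trans (le_of_eq ?_)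
  rw [← mul_sum, sum_filter_sum_sum_snoc_snoc_eq (fun Z => wt (univ.image Z) * ‖kernel 𝕜 W (m + 2) Z‖) i w]

end Laplacian

/-! ### §2 The linear part with one contraction at entry cost -/

section Door

variable {𝕜 : Type*} [RCLike 𝕜] {Γ : Type u} [LinearOrder Γ] [Fintype Γ] {wt : Finset Γ → ℝ}

/-- The `J = ∅` term of the prescribed binomial–Gram bound is the plain binomial term `C(2m', r) κ^{2m'−r} N`. [folklore] -/
private theorem binomialPrescribed_term_empty (r m' : ℕ) (κ N : ℝ) :
    (((r.factorial : ℝ))⁻¹ * ((∏ j ∈ univ.filter (fun j : Fin r => j ∉ (∅ : Finset (Fin r))), (2 * m' - (j : ℕ)) : ℕ) : ℝ)) *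
        ((2 * m' : ℕ) : ℝ) ^ (∅ : Finset (Fin r)).card * κ ^ (2 * m' - r) * N =
      ((2 * m').choose r : ℝ) * κ ^ (2 * m' - r) * N := by
  have hprod : ∏ j ∈ univ.filter (fun j : Fin r => j ∉ (∅ : Finset (Fin r))), (2 * m' - (j : ℕ)) = r ! * (2 * m').choose r := by
    rw [filter_true_of_mem fun j _ => Finset.notMem_empty j, Fin.prod_univ_eq_prod_range (fun j => 2 * m' - j) r,
      ← Nat.descFactorial_eq_prod_range, Nat.descFactorial_eq_factorial_mul_choose]
  have hr : (r ! : ℝ) ≠ 0 := by exact_mod_cast (Nat.factorial_pos r).ne'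
  rw [hprod, card_empty, pow_zero, mul_one]
  push_cast
  rw [inv_mul_cancel_left₀ hr]

/-- **THE LINEAR PART WITH ONE CONTRACTION AT ENTRY COST** (Salmhofer 1998 Prop. 1 along `t ↦ tC` + BGM 2006 (2.77)–(2.80), (2.86)–(2.90),
§3): for `C` replica-Gram-bounded with constant `κ ≥ 0` and entries `‖C(A,B)‖ ≤ s`, an even `H` whose degree-`2m'` kernels have
`wt`-weighted pinned norms `≤ N(m')` (every pin), and a tree weight `wt`: in every degree `m`, one output leg pinned,
`Σ_{X : X_i = w} wt(X) ‖kernel (e^{Δ_C} H) m X − kernel H m X‖ ≤ ((m+1)(m+2)/2) · s · Σ_{m' ≤ |Γ|/2, m+2 ≤ 2m'} C(2m', m+2) κ^{2m'−(m+2)} N(m')`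
— one power of the entry bound (`e^{Δ_C} − 1 = Δ_C ∫₀¹ e^{Δ_{tC}} dt`), the other contractions in Gram form, no factorial.
[cite: Salmhofer1998, §3.1 Prop. 1 and §4.1; BenfattoGiulianiMastropietro2006, (2.86)-(2.90)] -/
theorem sum_wt_norm_kernel_gaussConv_sub_le_entry_of_gramBounded (hwt : IsTreeWeight wt) (C : Matrix Γ Γ 𝕜) {κ : ℝ} (hκ : 0 ≤ κ)
    (hGB : IsGramBoundedR C κ) {s : ℝ} (hs : ∀ A B, ‖C A B‖ ≤ s) (H : GrassmannAlgebra 𝕜 Γ) (hH : H ∈ evenPart 𝕜 Γ)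
    (N : ℕ → ℝ) (hN0 : ∀ m', 0 ≤ N m')
    (hN : ∀ (m' : ℕ) (t : Fin (2 * m')) (a : Γ), ∑ Y ∈ univ.filter (fun Y : Fin (2 * m') → Γ => Y t = a),
      ‖kernel 𝕜 H (2 * m') Y‖ * wt (univ.image Y) ≤ N m')
    (m : ℕ) (i : Fin m) (w : Γ) :
    ∑ X ∈ univ.filter (fun X : Fin m → Γ => X i = w), wt (univ.image X) * ‖kernel 𝕜 (gaussConv 𝕜 C H) m X - kernel 𝕜 H m X‖ ≤
      (((m + 1) * (m + 2) : ℕ) : ℝ) / 2 * s *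
        ∑ m' ∈ range (Fintype.card Γ / 2 + 1),
          (if m + 2 ≤ 2 * m' then ((2 * m').choose (m + 2) : ℝ) * κ ^ (2 * m' - (m + 2)) * N m' else 0) := by
  have hs0 : 0 ≤ s := le_trans (norm_nonneg _) (hs w w)
  -- the Duhamel path `t ↦ e^{Δ_{tC}} H` and its derivative `Δ_C e^{Δ_{tC}} H`
  set Xc : ℝ → GrassmannAlgebra 𝕜 Γ := fun r => gaussConv 𝕜 (r • C) H with hXc
  have hpath : ∀ A B (t : ℝ), HasDerivAt (fun r : ℝ => (r • C) A B) (C A B) t := by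
    intro A B t
    have h := (hasDerivAt_id t).smul_const (C A B)
    simpa [Matrix.smul_apply] using h
  have hderiv : ∀ t ∈ Set.Icc (0 : ℝ) 1, HasCoeffDerivAt Xc (grassmannLaplacian 𝕜 C (gaussConv 𝕜 (t • C) H)) t :=
    fun t _ => hasCoeffDerivAt_gaussConv_apply (C := fun r : ℝ => r • C) (fun A B => hpath A B t) H
  -- the bound of the derivative's kernels, uniformly in `t`: one Laplacian at entry cost, then binomial–Gram for `e^{Δ_{tC}} H`
  set B : ℝ := (((m + 1) * (m + 2) : ℕ) : ℝ) / 2 * s *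
    ∑ m' ∈ range (Fintype.card Γ / 2 + 1),
      (if m + 2 ≤ 2 * m' then ((2 * m').choose (m + 2) : ℝ) * κ ^ (2 * m' - (m + 2)) * N m' else 0) with hB
  have hbound : ∀ t ∈ Set.Icc (0 : ℝ) 1, ∑ X ∈ univ.filter (fun X : Fin m → Γ => X i = w),
      wt (univ.image X) * ‖kernel 𝕜 (grassmannLaplacian 𝕜 C (gaussConv 𝕜 (t • C) H)) m X‖ ≤ B := by
    intro t ht
    refine (sum_wt_norm_kernel_grassmannLaplacian_le' hwt C hs _ m i w).trans ?_
    rw [hB]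
    refine mul_le_mul_of_nonneg_left ?_ (by positivity)
    have hGBt : IsGramBoundedR (t • C) κ := isGramBoundedR_real_smul hGB ht.1 ht.2
    have hNp : ∀ (m' : ℕ) (T : Finset (Fin (m + 1 + 1))), T ⊆ (∅ : Finset (Fin (m + 1 + 1))) →
        ∀ (ι : T → Fin (2 * m')), Function.Injective ι → ∀ (t' : Fin (2 * m')), (∀ j, ι j ≠ t') → ∀ a : Γ,
          ∑ Y ∈ univ.filter (fun Y : Fin (2 * m') → Γ => Y t' = a),
            ‖kernel 𝕜 H (2 * m') Y‖ * wt (univ.image Y) *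
              ∏ j : T, (if (fun (_ : Fin (m + 1 + 1)) (_ : Γ) => true) j (Y (ι j)) = true then (1 : ℝ) else 0) ≤
            (fun m'' (_ : ℕ) => N m'') m' T.card := by
      intro m' T hT ι _ t' _ a
      obtain rfl : T = ∅ := Finset.subset_empty.1 hT
      simp only [Finset.univ_eq_empty, Finset.prod_empty, mul_one]
      exact hN m' t' a
    have hdoor := sum_wt_norm_kernel_gaussConv_le_binomial_prescribed_of_gramBounded (wt := wt) (t • C) hwt hκ hGBt H hH
      (∅ : Finset (Fin (m + 1 + 1))) (fun _ _ => true) (fun m'' _ => N m'') (fun m'' _ => hN0 m'') hNp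
      (Fin.castSucc (Fin.castSucc i)) (Finset.notMem_empty _) w
    have hfilter : univ.filter (fun W : Fin (m + 1 + 1) → Γ => W (Fin.castSucc (Fin.castSucc i)) = w ∧
        ∀ j ∈ (∅ : Finset (Fin (m + 1 + 1))), (fun (_ : Fin (m + 1 + 1)) (_ : Γ) => true) j (W j) = true) =
        univ.filter (fun W : Fin (m + 1 + 1) → Γ => W (Fin.castSucc (Fin.castSucc i)) = w) :=
      filter_congr fun W _ => by simp
    rw [hfilter] at hdoor
    refine hdoor.trans (le_of_eq (sum_congr rfl fun m' _ => ?_))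
    split_ifs with h
    · exact binomialPrescribed_term_empty (m + 2) m' κ (N m')
    · rfl
  -- mean value along the path
  have hmvt := sum_mul_norm_kernel_sub_le_of_hasCoeffDerivAt hderiv m (univ.filter (fun X : Fin m → Γ => X i = w))
    (fun X => wt (univ.image X)) (fun X => hwt.nonneg _) hbound
  have h1 : Xc 1 = gaussConv 𝕜 C H := by simp only [hXc, one_smul]
  have h0 : Xc 0 = H := by simp only [hXc, zero_smul, gaussConv_zero, Module.End.one_apply]
  rw [h1, h0] at hmvt
  exact hmvt

/-- **The same in an even degree `2p` (the currency of a graded tower)**: prefactor `(p+1)(2p+1)·s`, contributions from the kernels of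
degree `2m' ≥ 2p+2`: `Σ_{X : X_i = w} wt(X) ‖kernel_{2p} (e^{Δ_C} H − H)(X)‖ ≤ (p+1)(2p+1)·s·Σ_{p+1 ≤ m' ≤ |Γ|/2} C(2m', 2p+2) κ^{2m'−(2p+2)} N(m')`
— first order of a near-identity step: ONE power of the small entry. [cite: BenfattoGiulianiMastropietro2006, (2.86)-(2.90)] -/
theorem sum_wt_norm_kernel_gaussConv_sub_le_entry_of_gramBounded_even (hwt : IsTreeWeight wt) (C : Matrix Γ Γ 𝕜) {κ : ℝ} (hκ : 0 ≤ κ)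
    (hGB : IsGramBoundedR C κ) {s : ℝ} (hs : ∀ A B, ‖C A B‖ ≤ s) (H : GrassmannAlgebra 𝕜 Γ) (hH : H ∈ evenPart 𝕜 Γ)
    (N : ℕ → ℝ) (hN0 : ∀ m', 0 ≤ N m')
    (hN : ∀ (m' : ℕ) (t : Fin (2 * m')) (a : Γ), ∑ Y ∈ univ.filter (fun Y : Fin (2 * m') → Γ => Y t = a),
      ‖kernel 𝕜 H (2 * m') Y‖ * wt (univ.image Y) ≤ N m')
    (p : ℕ) (i : Fin (2 * p)) (w : Γ) :
    ∑ X ∈ univ.filter (fun X : Fin (2 * p) → Γ => X i = w), wt (univ.image X) * ‖kernel 𝕜 (gaussConv 𝕜 C H - H) (2 * p) X‖ ≤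
      (((p + 1) * (2 * p + 1) : ℕ) : ℝ) * s *
        ∑ m' ∈ range (Fintype.card Γ / 2 + 1),
          (if p + 1 ≤ m' then ((2 * m').choose (2 * p + 2) : ℝ) * κ ^ (2 * m' - (2 * p + 2)) * N m' else 0) := by
  have h := sum_wt_norm_kernel_gaussConv_sub_le_entry_of_gramBounded hwt C hκ hGB hs H hH N hN0 hN (2 * p) i w
  have hcoef : (((2 * p + 1) * (2 * p + 2) : ℕ) : ℝ) / 2 = (((p + 1) * (2 * p + 1) : ℕ) : ℝ) := by
    push_cast
    ring
  have hker : ∀ X : Fin (2 * p) → Γ, kernel 𝕜 (gaussConv 𝕜 C H - H) (2 * p) X = kernel 𝕜 (gaussConv 𝕜 C H) (2 * p) X - kernel 𝕜 H (2 * p) X :=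
    fun X => by rw [sub_eq_add_neg, kernel_add, ← neg_one_smul 𝕜 H, kernel_smul, neg_one_mul, ← sub_eq_add_neg]
  simp only [hker]
  refine h.trans (le_of_eq ?_)
  rw [hcoef]
  congr 1
  refine sum_congr rfl fun m' _ => ?_
  have hiff : 2 * p + 2 ≤ 2 * m' ↔ p + 1 ≤ m' := by omega
  by_cases hm : p + 1 ≤ m'
  · rw [if_pos (hiff.2 hm), if_pos hm]
  · rw [if_neg (fun h' => hm (hiff.1 h')), if_neg hm]

end Door

end Literature.MathematicalPhysics.QuantumLattice

end
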